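import Summits.Langlands.Langlands.Theses.PicardMuOrdinary
import Literature.NumberTheory.GaloisRepresentations.PstWeilDeligne
import Literature.NumberTheory.GaloisRepresentations.FramedRepTwist
import Literature.NumberTheory.GaloisRepresentations.PstWeilDeligneTwistDeRham
import HarnessLib

/-!
# Route `PicardMuOrdinary`, crux `IrregularClassicality` (stmt-Langlands-13758), line `slope-free-polarized-limit`
# (skeleton r11): Stub F3 — `⊗`-stability of de Rham-ness for the twist by a de Rham character

`K = ℚ(ω)`, `ℓ = 3`.  The line proves the crux through a geometric representation `ρ_geo = ρ_C ⊗ ψ` (the `λ`-adic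
representation of the Picard curve twisted by the `3`-adic avatar of a CM Hecke character), which must be DE RHAM
at the place above `3` for Fontaine's pinned datum.  Given that `ρ_C` and `ψ` are de Rham there (stubs F1, F2),
Stub F3 is the `⊗`-stability step: for EVERY `p`-adic Hodge datum `𝔇 : PstWeilDeligneData F 3` of a
non-archimedean local field `F`, every framed `ρ : Γ_F →ₜ* GL_n(ℚ̄₃)` and `r : Γ_F →ₜ* GL_1(ℚ̄₃)` de Rham for `𝔇`,
the twist `ρ ⊗ det r` is de Rham for `𝔇`.

This is J.-M. Fontaine, *Représentations p-adiques semi-stables*, Astérisque 223 (1994), Exposé III,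
Prop. 1.5.2 (for a regular `(ℚ_p, Γ)`-ring `B` the `B`-admissible representations form a sub-Tannakian category:
stable under `⊗`, duals, sub-quotients), proved in the tree for every Fontaine-regular period-ring datum as
`Literature.NumberTheory.GaloisRepresentations.PstWeilDeligneData.IsDeRhamFramed.twist_det`
(file `Literature/NumberTheory/GaloisRepresentations/PstWeilDeligneTwistDeRham.lean`: comparison isomorphism
`exists_basis_mem_D_of_isAdmissible`, `⊗`-stability in pairing form `isAdmissible_of_pairing`, framed twist
`isAdmissible_restrictScalars_twist_det`, finite-model bookkeeping over the compositum of the two model fields).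
The registered stub is its specialisation to `ℓ = 3`, stated verbatim.

No `sorry`, no new definition, no named fact.
-/

open Literature.NumberTheory.GaloisRepresentations Literature.NumberTheory.Automorphic
open Literature.NumberTheory
open scoped NumberField
open IsDedekindDomain NumberField Polynomial Field

-- `Summit.Langlands.Langlands.…` (summit = sub-problem name, D-0017 layout) trips `dupNamespace` on every decl.
set_option linter.dupNamespace false
set_option autoImplicit false

noncomputable section

namespace Summit.Langlands.Langlands.Theorems.IrregularClassicality.SlopeFreePolarizedLimit

/-- **Stub F3 — `DeRhamTwistStability`** (line `slope-free-polarized-limit`, skeleton r11, crux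
`IrregularClassicality`): for every `p`-adic Hodge datum `𝔇` over a `3`-adic (indeed any non-archimedean local)
field `F`, the twist of a de Rham framed representation `ρ : Γ_F →ₜ* GL_n(ℚ̄₃)` by the determinant of a de Rham
rank-one representation `r : Γ_F →ₜ* GL_1(ℚ̄₃)` is de Rham — Fontaine 1994, Exp. III, Prop. 1.5.2
(`B`-admissible representations of a regular `(ℚ_p, Γ)`-ring are stable under `⊗`), i.e. the tree's
`PstWeilDeligneData.IsDeRhamFramed.twist_det` at `ℓ = 3`. [cite: FontaineAsterisque223III, Exp. III Prop. 1.5.2] -/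
theorem stub_deRhamTwistStability :
∀ (F : Type) [Field F] [ValuativeRel F] [TopologicalSpace F] [IsNonarchimedeanLocalField F]
  (𝔇 : PstWeilDeligneData F 3) (n : ℕ) (ρ : FramedRep (absoluteGaloisGroup F) (PadicAlgCl 3) n)
  (r : FramedRep (absoluteGaloisGroup F) (PadicAlgCl 3) 1),
  𝔇.IsDeRhamFramed ρ → 𝔇.IsDeRhamFramed r → 𝔇.IsDeRhamFramed (ρ.twist (FramedRep.det r)) :=
  fun _F _ _ _ _ _𝔇 _n _ρ _r hρ hr => hρ.twist_det hr

end Summit.Langlands.Langlands.Theorems.IrregularClassicality.SlopeFreePolarizedLimit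

end
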